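import Summits.CriticalPhenomena.PercolationContinuityZ3.Theorems.Transplant.KNLevelsTargetPropertyUniformP
import Summits.CriticalPhenomena.PercolationContinuityZ3.Theorems.Transplant.BoxProdZ2ChainU
import HarnessLib

/-!
# ONE `δ` for ALL parameters `q < 1`, all windows `π` and all subgraphs of `X □ ℤ²` (U2 for the product; design (D)'s "re-run at `q₀ < p`"):
# the `hstep` / `hchain` hypotheses of p2-g2's `KSchA.cond_of_tubeStep` / `KSchA.hreach_of_tubeChain` (KNCells2TubePackaging, p220676)
# for every parameter at once

builds on p205010 (kernel theorem, internal audit signed; external expert review pending) — through `KNLevels.targetPropertyUP_KN`.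
Lane `prim-bschramm`, seat `prim-bschramm-stmt` (gen 5); helper file (`--supports stmt-CriticalPhenomena-4575`).

Companion of `BoxProdZ2ChainU` (p218617: one `δ` for all subgraphs / all windows at ONE parameter).  Here the parameter moves inside:
* **`apply_step_subgraph_UP`**, **`chain_edge_subgraph_UP`** — `∃ δ ∈ (0,1], ∀ q < 1, ∀ G' ≤ X □ ℤ², …`;
* **`apply_step_tube_UP`** (= `hstep` of `cond_of_tubeStep` for all `q < 1`, all `π`), **`chain_tube_UP`**, **`chain_edge_tube_UP`** (= `hchain` of
  `hreach_of_tubeChain` for all `q < 1`, all `π`).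
So the instance of design (D) fixes `ε' ↦ δ_chain ↦ δ₂ ↦ K` BEFORE `p` (refuter p5-g3's D13), and the input accuracy `δ_in` at `p` serves every
`q ∈ [p/2, p]`.
[cite: KozmaNitzan2024, §4 Lemma 10 (p. 17), Lemma 11 (p. 22), Lemma 12 (pp. 23–25)]
-/

noncomputable section

open MeasureTheory ProbabilityTheory

namespace Summit.CriticalPhenomena.PercolationContinuityZ3.Theorems

namespace Transplant

namespace BoxProdZ2

open Literature.Probability.Percolation Literature.Probability.LatticeModels SimpleGraph KNLevels

variable {W : Type} [DecidableEq W] [Countable W] (X : SimpleGraph W) [X.LocallyFinite]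

/-! ## §1 One `δ` for all parameters and all subgraphs of `X □ ℤ²` -/

/-- **One application, uniformly over the parameters `q < 1` and the subgraphs of `X □ ℤ²`.** [cite: KozmaNitzan2024, §4 Lemma 10 (p. 17)] -/
theorem apply_step_subgraph_UP {Δ : ℕ} (hΔ : ∀ w, X.degree w ≤ Δ) {ε : ℝ} (hε : 0 < ε) :
    ∃ δ : ℝ, 0 < δ ∧ δ ≤ 1 ∧ ∀ (q : unitInterval), (q : ℝ) < 1 → ∀ (G' : SimpleGraph (W × Site 2)) [G'.LocallyFinite], G' ≤ (X □ zdGraph 2) →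
      ∀ (Wt : Sym2 (W × Site 2) → unitInterval) (s : TStep G'), s.KitsAt Wt q (Δ + 4) δ →
      1 - δ < (prodBernoulli Wt).real s.L.reachB → 1 - ε < (prodBernoulli Wt).real (⋃ t ∈ s.T, openConn s.L.o t) := by
  obtain ⟨δ, hδ, hδ1, h⟩ := (targetPropertyUP_KN (V := W × Site 2) (Δ := Δ + 4)).apply_step hε
  exact ⟨δ, hδ, hδ1, fun q hq1 G' _ hG' => h q hq1 G' (degree_le_of_subgraph X hΔ G' hG')⟩

/-- **Chains with enlarged targets, uniformly over the parameters `q < 1` and the subgraphs of `X □ ℤ²`** (true targets `T'_i ⊆ T_i`, excess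
`≤ η ≤ δ/2`). [cite: KozmaNitzan2024, §4 Lemma 11 (p. 22), Lemma 12 (pp. 23–25)] -/
theorem chain_edge_subgraph_UP {Δ : ℕ} (hΔ : ∀ w, X.degree w ≤ Δ) (n : ℕ) {ε : ℝ} (hε : 0 < ε) :
    ∃ δ : ℝ, 0 < δ ∧ δ ≤ 1 ∧ ∀ (q : unitInterval), (q : ℝ) < 1 → ∀ (G' : SimpleGraph (W × Site 2)) [G'.LocallyFinite], G' ≤ (X □ zdGraph 2) →
      ∀ (Wt : Sym2 (W × Site 2) → unitInterval) (s : Fin (n + 1) → TStep G') (T' : Fin (n + 1) → Finset (W × Site 2)) (η : ℝ),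
      (∀ i : Fin (n + 1), (s i).L.o = (s 0).L.o) →
      (∀ i : Fin n, T' (Fin.castSucc i) ⊆ (s i.succ).L.X 0) →
      (∀ i : Fin (n + 1), T' i ⊆ (s i).T) →
      (∀ i : Fin (n + 1), (s i).KitsAt Wt q (Δ + 4) δ) →
      η ≤ δ / 2 →
      (∀ i : Fin (n + 1), (prodBernoulli Wt).real (⋃ t ∈ (s i).T \ T' i, openConn (s 0).L.o t) ≤ η) →
      1 - δ < (prodBernoulli Wt).real (s 0).L.reachB →
        1 - ε < (prodBernoulli Wt).real (⋃ t ∈ T' (Fin.last n), openConn (s 0).L.o t) := by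
  obtain ⟨δ, hδ, hδ1, h⟩ := (targetPropertyUP_KN (V := W × Site 2) (Δ := Δ + 4)).chain_edge n hε
  exact ⟨δ, hδ, hδ1, fun q hq1 G' _ hG' => h q hq1 G' (degree_le_of_subgraph X hΔ G' hG')⟩

/-! ## §2 One `δ` for all parameters and all window tube graphs -/

/-- **One application, uniformly over the parameters `q < 1` and the windows `π`** — the `hstep` hypothesis of `KSchA.cond_of_tubeStep`
(face input) and of the root probe, for every parameter at once. [cite: KozmaNitzan2024, §4 Lemma 10 (p. 17)] -/
theorem apply_step_tube_UP {Δ : ℕ} (hΔ : ∀ w, X.degree w ≤ Δ) {ε : ℝ} (hε : 0 < ε) :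
    ∃ δ : ℝ, 0 < δ ∧ δ ≤ 1 ∧ ∀ (q : unitInterval), (q : ℝ) < 1 →
      ∀ (π : Finset W) (Wt : Sym2 (W × Site 2) → unitInterval) (s : TStep (tubeGraph X π)),
      s.KitsAt Wt q (Δ + 4) δ → 1 - δ < (prodBernoulli Wt).real s.L.reachB → 1 - ε < (prodBernoulli Wt).real (⋃ t ∈ s.T, openConn s.L.o t) := by
  obtain ⟨δ, hδ, hδ1, h⟩ := apply_step_subgraph_UP X hΔ hε
  exact ⟨δ, hδ, hδ1, fun q hq1 π => h q hq1 (tubeGraph X π) (tubeGraph_le X π)⟩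

/-- **Chains, uniformly over the parameters `q < 1` and the windows `π`.** [cite: KozmaNitzan2024, §4 Lemma 11 (p. 22), Lemma 12 (p. 24)] -/
theorem chain_tube_UP {Δ : ℕ} (hΔ : ∀ w, X.degree w ≤ Δ) (n : ℕ) {ε : ℝ} (hε : 0 < ε) :
    ∃ δ : ℝ, 0 < δ ∧ δ ≤ 1 ∧ ∀ (q : unitInterval), (q : ℝ) < 1 →
      ∀ (π : Finset W) (Wt : Sym2 (W × Site 2) → unitInterval) (s : Fin (n + 1) → TStep (tubeGraph X π)),
      (∀ i : Fin (n + 1), (s i).L.o = (s 0).L.o) →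
      (∀ i : Fin n, (s (Fin.castSucc i)).T ⊆ (s i.succ).L.X 0) →
      (∀ i : Fin (n + 1), (s i).KitsAt Wt q (Δ + 4) δ) →
      1 - δ < (prodBernoulli Wt).real (s 0).L.reachB →
        1 - ε < (prodBernoulli Wt).real (⋃ t ∈ (s (Fin.last n)).T, openConn (s 0).L.o t) := by
  obtain ⟨δ, hδ, hδ1, h⟩ := (targetPropertyUP_KN (V := W × Site 2) (Δ := Δ + 4)).chain n hε
  exact ⟨δ, hδ, hδ1, fun q hq1 π => h q hq1 (tubeGraph X π) (degree_le_of_subgraph X hΔ _ (tubeGraph_le X π))⟩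

/-- **Chains with enlarged targets, uniformly over the parameters `q < 1` and the windows `π`** — the `hchain` hypothesis of
`KSchA.hreach_of_tubeChain` (the 87-step corridor chain of design (D)) for every parameter at once: the scheme's `δc := δ_chain(ε')` is fixed
before `p`. [cite: KozmaNitzan2024, §4 Lemma 11 (p. 22), Lemma 12 (pp. 23–25)] -/
theorem chain_edge_tube_UP {Δ : ℕ} (hΔ : ∀ w, X.degree w ≤ Δ) (n : ℕ) {ε : ℝ} (hε : 0 < ε) :
    ∃ δ : ℝ, 0 < δ ∧ δ ≤ 1 ∧ ∀ (q : unitInterval), (q : ℝ) < 1 →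
      ∀ (π : Finset W) (Wt : Sym2 (W × Site 2) → unitInterval) (s : Fin (n + 1) → TStep (tubeGraph X π))
      (T' : Fin (n + 1) → Finset (W × Site 2)) (η : ℝ),
      (∀ i : Fin (n + 1), (s i).L.o = (s 0).L.o) →
      (∀ i : Fin n, T' (Fin.castSucc i) ⊆ (s i.succ).L.X 0) →
      (∀ i : Fin (n + 1), T' i ⊆ (s i).T) →
      (∀ i : Fin (n + 1), (s i).KitsAt Wt q (Δ + 4) δ) →
      η ≤ δ / 2 →
      (∀ i : Fin (n + 1), (prodBernoulli Wt).real (⋃ t ∈ (s i).T \ T' i, openConn (s 0).L.o t) ≤ η) →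
      1 - δ < (prodBernoulli Wt).real (s 0).L.reachB →
        1 - ε < (prodBernoulli Wt).real (⋃ t ∈ T' (Fin.last n), openConn (s 0).L.o t) := by
  obtain ⟨δ, hδ, hδ1, h⟩ := chain_edge_subgraph_UP X hΔ n hε
  exact ⟨δ, hδ, hδ1, fun q hq1 π => h q hq1 (tubeGraph X π) (tubeGraph_le X π)⟩

end BoxProdZ2

end Transplant

end Summit.CriticalPhenomena.PercolationContinuityZ3.Theorems

end
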